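import Summits.CriticalPhenomena.PercolationContinuityZ3.Theorems.Transplant.SkelFrmQuasiBParamsFaceLatA
import Summits.CriticalPhenomena.PercolationContinuityZ3.Theorems.Transplant.SkelFrmBParamsFaceLatA
import Summits.CriticalPhenomena.PercolationContinuityZ3.Theorems.Transplant.SkelNegBParamsFaceLatA
import Summits.CriticalPhenomena.PercolationContinuityZ3.Theorems.Transplant.SkelFrmQuasiBParamsFace
import Summits.CriticalPhenomena.PercolationContinuityZ3.Theorems.Transplant.SkelFrmBParamsFace
import Summits.CriticalPhenomena.PercolationContinuityZ3.Theorems.Transplant.SkelNegBParamsFace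
import Summits.CriticalPhenomena.PercolationContinuityZ3.Theorems.Transplant.SkelFrmFrom1SlotTypes
import Summits.CriticalPhenomena.PercolationContinuityZ3.Theorems.Transplant.SkelFrm1SlotTypes
import Summits.CriticalPhenomena.PercolationContinuityZ3.Theorems.Transplant.SkelFrmQuasi1ParamsPO
import Summits.CriticalPhenomena.PercolationContinuityZ3.Theorems.Transplant.SkelFrm1ParamsPO
import Summits.CriticalPhenomena.PercolationContinuityZ3.Theorems.Transplant.SkelFrmQuasi1ParamsLBL
import Summits.CriticalPhenomena.PercolationContinuityZ3.Theorems.Transplant.SkelFrm1ParamsLBL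
import Summits.CriticalPhenomena.PercolationContinuityZ3.Theorems.Transplant.SkelFrmFromBParamsKitA
import Summits.CriticalPhenomena.PercolationContinuityZ3.Theorems.Transplant.SkelFrmBParamsKitA
import Summits.CriticalPhenomena.PercolationContinuityZ3.Theorems.Transplant.SkelFrmQuasiBParamsKitS
import Summits.CriticalPhenomena.PercolationContinuityZ3.Theorems.Transplant.SkelFrmBParamsKitS
import Summits.CriticalPhenomena.PercolationContinuityZ3.Theorems.Transplant.SkelFrmQuasi1ParamsLF
import Summits.CriticalPhenomena.PercolationContinuityZ3.Theorems.Transplant.SkelFrm1ParamsLF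
import Summits.CriticalPhenomena.PercolationContinuityZ3.Theorems.Transplant.SkelFrmFrom1ParamsLO
import Summits.CriticalPhenomena.PercolationContinuityZ3.Theorems.Transplant.SkelFrm1ParamsLO
import Summits.CriticalPhenomena.PercolationContinuityZ3.Theorems.Transplant.SkelFrmQuasiBParamsLF
import Summits.CriticalPhenomena.PercolationContinuityZ3.Theorems.Transplant.SkelFrmBParamsLF
import Summits.CriticalPhenomena.PercolationContinuityZ3.Theorems.Transplant.SkelFrmQuasiBParamsFineSize
import Summits.CriticalPhenomena.PercolationContinuityZ3.Theorems.Transplant.SkelFrmBParamsFineSize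
import Summits.CriticalPhenomena.PercolationContinuityZ3.Theorems.Transplant.SkelFrmQuasiBParamsLFA
import Summits.CriticalPhenomena.PercolationContinuityZ3.Theorems.Transplant.SkelFrmBParamsLFA
import Summits.CriticalPhenomena.PercolationContinuityZ3.Theorems.Transplant.SkelFrmQuasiBParamsLO
import Summits.CriticalPhenomena.PercolationContinuityZ3.Theorems.Transplant.SkelFrmBParamsLO
import Summits.CriticalPhenomena.PercolationContinuityZ3.Theorems.Transplant.SkelFrmFromBParamsB
import Summits.CriticalPhenomena.PercolationContinuityZ3.Theorems.Transplant.SkelFrmBParamsB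
import Summits.CriticalPhenomena.PercolationContinuityZ3.Theorems.Transplant.SkelFrmQuasiBParamsFineSizeA
import Summits.CriticalPhenomena.PercolationContinuityZ3.Theorems.Transplant.SkelFrmBParamsFineSizeA
import Summits.CriticalPhenomena.PercolationContinuityZ3.Theorems.Transplant.SkelFrmFromBParamsSlotsR
import Summits.CriticalPhenomena.PercolationContinuityZ3.Theorems.Transplant.SkelFrmBParamsSlotsR
import Summits.CriticalPhenomena.PercolationContinuityZ3.Theorems.Transplant.SkelFrmQuasiBParamsSlotsRS
import Summits.CriticalPhenomena.PercolationContinuityZ3.Theorems.Transplant.SkelFrmBParamsSlotsRS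
import Summits.CriticalPhenomena.PercolationContinuityZ3.Theorems.Transplant.SkelFrmQuasiBParamsSlots
import Summits.CriticalPhenomena.PercolationContinuityZ3.Theorems.Transplant.SkelFrmBParamsSlots
import Summits.CriticalPhenomena.PercolationContinuityZ3.Theorems.Transplant.SkelFrmFromBParamsSched
import Summits.CriticalPhenomena.PercolationContinuityZ3.Theorems.Transplant.SkelFrmBParamsSched
import Summits.CriticalPhenomena.PercolationContinuityZ3.Theorems.Transplant.SkelFrmQuasiBParamsSlotsT
import Summits.CriticalPhenomena.PercolationContinuityZ3.Theorems.Transplant.SkelFrmBParamsSlotsT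
import Summits.CriticalPhenomena.PercolationContinuityZ3.Theorems.Transplant.SkelFrmFromBParamsReachFC
import Summits.CriticalPhenomena.PercolationContinuityZ3.Theorems.Transplant.SkelFrmBParamsReachFC
import Summits.CriticalPhenomena.PercolationContinuityZ3.Theorems.Transplant.SkelFrmQuasiBParamsSlotsTA
import Summits.CriticalPhenomena.PercolationContinuityZ3.Theorems.Transplant.SkelFrmBParamsSlotsTA
import Summits.CriticalPhenomena.PercolationContinuityZ3.Theorems.Transplant.SkelFrmFromBParamsFaceLat
import Summits.CriticalPhenomena.PercolationContinuityZ3.Theorems.Transplant.SkelFrmBParamsFaceLat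
import Summits.CriticalPhenomena.PercolationContinuityZ3.Theorems.Transplant.SkelNegBParamsFaceA
import Summits.CriticalPhenomena.PercolationContinuityZ3.Theorems.Transplant.PlanarSkeletonFrmQuasiDefs
import Summits.CriticalPhenomena.PercolationContinuityZ3.Theorems.Transplant.PlanarSkeletonFrmDefs
import Summits.CriticalPhenomena.PercolationContinuityZ3.Theorems.Transplant.SkelPhiStepIDataNS
import Summits.CriticalPhenomena.PercolationContinuityZ3.Theorems.Transplant.SkelFrmQuasiBChoiceDefs
import Summits.CriticalPhenomena.PercolationContinuityZ3.Theorems.Transplant.SkelFrmQuasiBParamsSchedA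
import HarnessLib
import Summits.CriticalPhenomena.PercolationContinuityZ3.Theorems.Transplant.SkelFrmBParamsFaceA
/-!
# GEN-Q PORT (WAVE-Q table v0.8 section 2, row G112, U-level L14; captain R-6/R-7 2026-08-27: carrier token swap `PlanarSkeletonFrmFrom ↦ PlanarSkeletonFrmQuasi`)
# of the tree module «Transplant/SkelFrmFromBParamsFaceA» (sha256 4f0a2440b0f94546…) onto the quasi-step carrier `PlanarSkeletonFrmQuasi` (p507026): «SkelFrmQuasiBParamsFaceA»

ORIGINAL TITLE: N2 (frames-only node `SamePDropOfSkeletonFrmFrom₁`, OPEN) params column over `PlanarSkeletonFrm` — (ζ″) ledger, shape (B′) of record ((R-14)):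

builds on p205010 (kernel theorem, internal audit signed; external expert review pending) — nothing in this file uses p205010; NOTHING is claimed about any open node
((N3-b), the end state).  Lane `prim-bschramm`, seat `prim-bschramm-stmt` (gen 33; GEN-Q column pen; tool = captain gen-1 g4's port_genq.py R-14 --cone + p3-g30's T1 patch).  Helper file (`--supports stmt-CriticalPhenomena-4575 --as helper`).
PORT RULES (U-wave r1–r4 re-used, GEN-Q hunk classes of p3-g29 #6136): declaration order, names and proof texts are those of «SkelFrmFromBParamsFaceA», byte-identical except
(i) the carrier token `PlanarSkeletonFrmFrom ↦ PlanarSkeletonFrmQuasi` in binders, `namespace`/`end` lines and qualified names (module names `SkelFrmFrom… ↦ SkelFrmQuasi…`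
in imports of already-ported rows); (ii) `Φ.step ↦ Φ.qstep` with the called Steps lemma replaced by its `…Q`/`_q` twin and the cost `Φ.M` threaded (none in this file unless
listed below); (iii) `Φ.cyl_connected ↦ Φ.cyl_reach` readers (none unless listed); (iv) graph-ball radii / window floors ×`Φ.M` (none unless listed).  Carrier-free
residents stay imported/exported from the original «SkelFrmBParamsFaceA» exactly as in the FrmFrom port.  Docstrings and citations are the original's.

-/

noncomputable section

open scoped Classical

namespace Summit.CriticalPhenomena.PercolationContinuityZ3.Theorems.Transplant

namespace PlanarSkeletonFrmQuasi

namespace NegB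

open Literature.Probability.Percolation Literature.Probability.LatticeModels SimpleGraph
open Literature.Probability.Percolation.KozmaNitzan.Cells (oth)
open SkelConc (Consts)
open Skelφ.StepI (DataN)
open TwoAxis.Para (modulus)
open Neg

/-! ## §1 Lattice facts at `prFA`: `D_A ≤ L₀·L₁`, `Mabs ≤ 2·rdK_I·D_A`, `awNum` unfolded -/

section Lattice

/-- **`D_A ≤ L₀·L₁`** (`D_A = A²·m`, `L₀ = A(|v_L|+|v_β|)`, `L₁ = A(|n|+|h|)`). [folklore] -/
theorem D_le_L_mulA (κ : Consts) {V : Type} [DecidableEq V] [Countable V] {G : SimpleGraph V} [G.LocallyFinite] (Φ : PlanarSkeletonFrmQuasi G) (t : V) (p : unitInterval) (D : Skelφ.StepI.DataNS V) (g : ℕ) (f : ℕ) : (prFA κ Φ t p D g f).D ≤ (prFA κ Φ t p D g f).L 0 * (prFA κ Φ t p D g f).L 1 := by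
  obtain ⟨hA, hn, hh, hvα, hvβ, -, -, hD⟩ := prFA_fields κ Φ t p D g f
  have hm := modulus_le_Lhat_mul κ Φ t p D g f
  have hA0 : 0 ≤ Aof κ := (Aof_pos κ).1.le
  rw [Skelφ.FinePrm.L_zero, Skelφ.FinePrm.L_one, hA, hn, hh, hvα, hvβ, hD, Skelφ.NegPrm.DofA_eq, abs_of_nonneg hA0]
  change Aof κ ^ 2 * modulus (nL κ Φ t p D g f) (hL κ Φ t p D g f) (vL κ Φ t p D g f) (vβL κ Φ t p D g f) ≤ _
  have hm0 : 0 ≤ (|vL κ Φ t p D g f| + |vβL κ Φ t p D g f|) * (|(nL κ Φ t p D g f : ℤ)| + |hL κ Φ t p D g f|) := by positivity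
  have hA2 : 0 ≤ Aof κ ^ 2 := pow_nonneg hA0 2
  calc Aof κ ^ 2 * modulus (nL κ Φ t p D g f) (hL κ Φ t p D g f) (vL κ Φ t p D g f) (vβL κ Φ t p D g f)
      ≤ Aof κ ^ 2 * ((|vL κ Φ t p D g f| + |vβL κ Φ t p D g f|) * (|(nL κ Φ t p D g f : ℤ)| + |hL κ Φ t p D g f|)) :=
        mul_le_mul_of_nonneg_left hm hA2
    _ = Aof κ * (|vL κ Φ t p D g f| + |vβL κ Φ t p D g f|) * (Aof κ * (|(nL κ Φ t p D g f : ℤ)| + |hL κ Φ t p D g f|)) := by ring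

/-- **`Mabs ≤ 2·rdK I (bOf I)·D_A`** for both level axes (the `A` cancels). [folklore] -/
theorem Mabs_le_two_rdK_DA (κ : Consts) {V : Type} [DecidableEq V] [Countable V] {G : SimpleGraph V} [G.LocallyFinite] (Φ : PlanarSkeletonFrmQuasi G) (t : V) (p : unitInterval) (D : Skelφ.StepI.DataNS V) (g : ℕ) (f : ℕ) (hN : EqNumL κ Φ t p D g f) (I : Fin 2) :
    (prFA κ Φ t p D g f).Mabs ≤ 2 * (prFA κ Φ t p D g f).rdK I ((prFA κ Φ t p D g f).bOf I) * (prFA κ Φ t p D g f).D := by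
  set pr := prFA κ Φ t p D g f
  have hM := Mabs_eqA κ Φ t p D g f hN
  have hDL := D_le_L_mulA κ Φ t p D g f
  have hx := rdK_lowerA κ Φ t p D g f I
  have hJ := cL_upperA κ Φ t p D g f hN (oth I)
  have hAp : 0 < Aof κ := (Aof_pos κ).1
  have hDpos : 0 < pr.D := by
    obtain ⟨hn1, hℓ1⟩ := one_le_of_eqNumL κ Φ t p D g f hN
    have e : pr.D = Skelφ.NegPrm.DofA (Aof κ) (nL κ Φ t p D g f) (hL κ Φ t p D g f) (ℓL κ Φ t p D g f) (vL κ Φ t p D g f) :=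
      (prFA_fields κ Φ t p D g f).2.2.2.2.2.2.2
    rw [e]; exact Skelφ.NegPrm.DofA_pos (Aof_pos κ).2 hn1 hℓ1 _ _
  obtain ⟨hc₀, hc₁⟩ := prFA_c_pos κ Φ t p D g f
  have hcI : 0 < pr.cOf I := pr.cOf_pos hc₀ hc₁ I
  have hLJ : 0 < pr.L (oth I) := by
    have hnz := pr.lvGen_bOf_ne_zero (oth I) (pr.lvGen_ne_zero_of_detD_pos (prFA_D κ Φ t p D g f) hDpos (oth I))
    have hA : pr.A = Aof κ := (prFA_fields κ Φ t p D g f).1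
    have hb : |pr.lvGen (oth I) (pr.bOf (oth I))| ≤ |pr.lvGen (oth I) 0| + |pr.lvGen (oth I) 1| := by
      obtain h | h : pr.bOf (oth I) = 0 ∨ pr.bOf (oth I) = 1 := by
        generalize pr.bOf (oth I) = b; exact (by fin_cases b <;> simp)
      · rw [h]; linarith [abs_nonneg (pr.lvGen (oth I) 1)]
      · rw [h]; linarith [abs_nonneg (pr.lvGen (oth I) 0)]
    unfold Skelφ.FinePrm.L; rw [hA, abs_of_pos hAp]
    have : 0 < |pr.lvGen (oth I) (pr.bOf (oth I))| := abs_pos.2 hnz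
    have hs : 0 < |pr.lvGen (oth I) 0| + |pr.lvGen (oth I) 1| := by linarith
    exact mul_pos hAp hs
  -- `c₀·c₁ = c_I·c_J` and `L 0 · L 1 = L_I · L_J`
  have hcc : pr.c₀ * pr.c₁ = pr.cOf I * pr.cOf (oth I) := by
    obtain rfl | rfl : I = 0 ∨ I = 1 := by fin_cases I <;> simp
    · rw [Skelφ.FinePrm.cOf_zero, show oth (0 : Fin 2) = 1 from rfl, Skelφ.FinePrm.cOf_one]
    · rw [Skelφ.FinePrm.cOf_one, show oth (1 : Fin 2) = 0 from rfl, Skelφ.FinePrm.cOf_zero, mul_comm]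
  have hLL : pr.L 0 * pr.L 1 = pr.L I * pr.L (oth I) := by
    obtain rfl | rfl : I = 0 ∨ I = 1 := by fin_cases I <;> simp
    · rw [show oth (0 : Fin 2) = 1 from rfl]
    · rw [show oth (1 : Fin 2) = 0 from rfl, mul_comm]
  rw [hcc] at hM; rw [hLL] at hDL
  -- `A·M·L_J = c_I·(c_J L_J)·D ≤ c_I·D·D ≤ c_I·D·L_I·L_J ≤ 2A·x·D·L_J`
  have h1 : Aof κ * pr.Mabs * pr.L (oth I) ≤ pr.cOf I * pr.D * pr.D := by
    have : Aof κ * pr.Mabs * pr.L (oth I) = pr.cOf I * (pr.cOf (oth I) * pr.L (oth I)) * pr.D := by rw [hM]; ring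
    rw [this]
    have hcD : 0 ≤ pr.cOf I * pr.D := (mul_pos hcI hDpos).le
    nlinarith
  have h2 : pr.cOf I * pr.D * pr.D ≤ 2 * Aof κ * pr.rdK I (pr.bOf I) * pr.D * pr.L (oth I) := by
    have hcD : 0 ≤ pr.cOf I * pr.D := (mul_pos hcI hDpos).le
    have hDL' : 0 ≤ pr.D * pr.L (oth I) := (mul_pos hDpos hLJ).le
    calc pr.cOf I * pr.D * pr.D ≤ pr.cOf I * pr.D * (pr.L I * pr.L (oth I)) := mul_le_mul_of_nonneg_left hDL hcD
      _ = (pr.cOf I * pr.L I) * (pr.D * pr.L (oth I)) := by ring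
      _ ≤ (2 * Aof κ * pr.rdK I (pr.bOf I)) * (pr.D * pr.L (oth I)) := mul_le_mul_of_nonneg_right hx hDL'
      _ = 2 * Aof κ * pr.rdK I (pr.bOf I) * pr.D * pr.L (oth I) := by ring
  have h3 : (Aof κ * pr.Mabs) * pr.L (oth I) ≤ (Aof κ * (2 * pr.rdK I (pr.bOf I) * pr.D)) * pr.L (oth I) := by linarith
  have h4 := le_of_mul_le_mul_right h3 hLJ
  exact le_of_mul_le_mul_left (by linarith) hAp

-- GEN-Q (R-2, captain 2026-08-27): `PlanarSkeletonFrmFrom.NegB.awNum_eqA` is not in the used cone of the node top — not ported.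

end Lattice

/-! ## §2 The (F) floor `hkF` at `g := gT` -/

section AtT

-- GEN-Q (R-2, captain 2026-08-27): `PlanarSkeletonFrmFrom.NegB.hkF_RA` is not in the used cone of the node top — not ported.

end AtT

end NegB

end PlanarSkeletonFrmQuasi

end Summit.CriticalPhenomena.PercolationContinuityZ3.Theorems.Transplant
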